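import Summits.CriticalPhenomena.PercolationContinuityZ3.Theorems.SoloBlindKNQuestion7
import Literature.Computation.FiniteGraph.ReliabilityBridge
import HarnessLib

/-!
# `NoHeavyLowerTail` (stmt-CriticalPhenomena-4575) — the typed `SoloBlindKN.KNQuestion8` needs a non-degeneracy guard: with a SURE edge making
# `P(0 ↔ A) = 1` every relay is a "minimiser" of `P(a ↔ b, 0 ↮ A) = 0`, and (41) fails at `a = b ∈ A`

Support file (`--supports stmt-CriticalPhenomena-4575`), prover `prim-ineq-gen-7` (gen 7).  No definitions, no named facts, no sorries; standard axioms.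

Kozma–Nitzan's Question 8 (arXiv:2401.12397, p. 36): "Let `a` be the point minimising `P(a ↔ b, 0 ↮ A)` among the points of `A`. Is it true that in this case
(41) holds?"  The tree types it (`SoloBlindKN.KNQuestion8 w A o`) as "for EVERY `b` and EVERY minimiser `a`".  The census of this seat (kit j085537: 59M
instances, FINDING-Q89-g7) found no violation with a unique minimiser or a positive minimal score, but 1.3M 'violations' in the degenerate situation
`P(0 ↔ A) = 1` (possible with weight-1 pairs, which the typing `w : Sym2 V → [0,1]` allows): then every score vanishes, every `a ∈ A` is a minimiser, and
(41) at `a = b ∈ A` reads `P(0 ↔ b) ≥ P(0 ↔ A) = 1`.  The 3-vertex witness below (`0 —1— 1`, `0 —½— 2`, `A = {1,2}`, `b = a = 2`) makes this a theorem: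
`SoloBlindKN.not_knQuestion8_sure_witness`.  Consequence for planners: any bridge `(∀ V w A o, KNQuestion8 w A o) → …` is vacuous; the faithful typing adds
"`a` is the UNIQUE minimiser" or "`0 < min_a P(a ↔ b, 0 ↮ A)`" or forbids weight-1 pairs (under which reading the census has 0 violations).
[cite: KozmaNitzan2024, Question 8 (p. 36)]
-/

noncomputable section

namespace Summit.CriticalPhenomena.PercolationContinuityZ3.Theorems

open MeasureTheory Set Literature.Probability.LatticeModels Literature.Probability.Percolation
open Literature.Computation.FiniteGraph
open scoped Classical

namespace SoloBlindKN

/-- The witness edge list: `{0,1}` sure, `{0,2}` with probability `1/2` (no edge `{1,2}`). [folklore] -/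
def q8Edges : List PercEdge := [(0, 1, 1, 1), (0, 2, 1, 2)]

/-- The witness list is well formed. [folklore] -/
theorem q8Edges_ok : edgesOK 3 q8Edges = true := by decide

/-- `P(0 ↔ 1) = 1` on the witness. [folklore] -/
theorem q8_conn01 : connProb 3 q8Edges 0 [1] = 1 := by decide +kernel

/-- `P(0 ↔ 2) = 1/2` on the witness. [folklore] -/
theorem q8_conn02 : connProb 3 q8Edges 0 [2] = 1 / 2 := by decide +kernel

/-- **The typed Question 8 fails at the sure-edge witness**: `¬ KNQuestion8 (edgeWeight 3 q8Edges) {1, 2} 0`.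
[cite: KozmaNitzan2024, Question 8 (p. 36)] -/
theorem not_knQuestion8_sure_witness :
    ¬ KNQuestion8 (edgeWeight 3 q8Edges) ({(1 : Fin 3), (2 : Fin 3)} : Finset (Fin 3)) (0 : Fin 3) := by
  intro h
  set μ := prodBernoulli (edgeWeight 3 q8Edges) with hμ
  set A : Finset (Fin 3) := {(1 : Fin 3), (2 : Fin 3)} with hA
  have hmeas : ∀ S : Set (BondConfig (Fin 3)), MeasurableSet S := fun _ => MeasurableSet.of_discrete
  -- the two computed probabilities
  have h01 : μ.real (openConn (0 : Fin 3) (1 : Fin 3)) = 1 := by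
    have e := prodBernoulli_real_openConn_eq (n := 3) q8Edges_ok (o := 0) (b := 1) (by decide) (by decide)
    rw [q8_conn01] at e
    simpa using e
  have h02 : μ.real (openConn (0 : Fin 3) (2 : Fin 3)) = 1 / 2 := by
    have e := prodBernoulli_real_openConn_eq (n := 3) q8Edges_ok (o := 0) (b := 2) (by decide) (by decide)
    rw [q8_conn02] at e
    simpa using e
  -- `P(0 ↔ A) = 1`
  have hsub : (openConn (0 : Fin 3) (1 : Fin 3) : Set (BondConfig (Fin 3))) ⊆ connTo (0 : Fin 3) A := by
    intro ω hω
    simp only [connTo, hA, mem_iUnion, exists_prop]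
    exact ⟨1, by simp, hω⟩
  have hC1 : μ.real (connTo (0 : Fin 3) A) = 1 :=
    le_antisymm measureReal_le_one (h01 ▸ measureReal_mono hsub)
  have hdiff0 : ∀ X : Set (BondConfig (Fin 3)), μ.real (X \ connTo (0 : Fin 3) A) = 0 := by
    intro X
    have hle : μ.real (X \ connTo (0 : Fin 3) A) ≤ μ.real ((connTo (0 : Fin 3) A)ᶜ) := measureReal_mono (fun ω hω => hω.2)
    rw [probReal_compl_eq_one_sub (hmeas _), hC1, sub_self] at hle
    exact le_antisymm hle measureReal_nonneg
  -- Question 8 at `b = 2`, `a = 2 ∈ A`: the hypothesis holds (all scores are `0`)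
  have h2A : (2 : Fin 3) ∈ A := by simp [hA]
  have hyp : ∀ a' ∈ A, μ.real (openConn (2 : Fin 3) (2 : Fin 3) \ connTo (0 : Fin 3) A) ≤
      μ.real (openConn a' (2 : Fin 3) \ connTo (0 : Fin 3) A) := by
    intro a' _
    rw [hdiff0, hdiff0]
  have concl := h (2 : Fin 3) (2 : Fin 3) h2A hyp
  -- but the conclusion says `1 ≤ 1/2`
  have hL : μ.real (openConn (2 : Fin 3) (2 : Fin 3) ∩ connTo (0 : Fin 3) A) = 1 := by
    have huniv : (openConn (2 : Fin 3) (2 : Fin 3) : Set (BondConfig (Fin 3))) = univ :=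
      eq_univ_of_forall fun ω => SimpleGraph.Reachable.refl _
    rw [huniv, univ_inter, hC1]
  have hR : μ.real (openConn (0 : Fin 3) (2 : Fin 3) ∩ connTo (0 : Fin 3) A) ≤ 1 / 2 :=
    h02 ▸ measureReal_mono inter_subset_left
  change μ.real (openConn (2 : Fin 3) (2 : Fin 3) ∩ connTo (0 : Fin 3) A) ≤
    μ.real (openConn (0 : Fin 3) (2 : Fin 3) ∩ connTo (0 : Fin 3) A) at concl
  linarith

/-- Hence the universally quantified typed Question 8 is false as stated (degenerate designations must be excluded).
[cite: KozmaNitzan2024, Question 8 (p. 36)] -/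
theorem not_forall_knQuestion8 :
    ¬ ∀ (n : ℕ) (w : Sym2 (Fin n) → unitInterval) (A : Finset (Fin n)) (o : Fin n), KNQuestion8 w A o :=
  fun h => not_knQuestion8_sure_witness (h 3 _ _ _)

end SoloBlindKN

end Summit.CriticalPhenomena.PercolationContinuityZ3.Theorems

end
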